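import Mathlib.Analysis.SpecialFunctions.Pow.Real
import Mathlib.Analysis.SpecialFunctions.Log.Basic
import Mathlib.Data.Nat.MaxPowDiv
import Mathlib.Tactic.Group
import Literature.NumberTheory.LFunctions.AutomaticSequenceTransducerPeriod
import HarnessLib

/-!
# The carry property of the naturally induced transducer (Müllner 2017, Def. 4.1 and Lemma 4.10; proved)

Everything in this file is PROVED (plus plain definitions). It formalises §4.2 of C. Müllner,
*Automatic sequences fulfill the Sarnak conjecture* (Duke Math. J. 166 (2017)) — the CARRY
PROPERTY (Def. 4.1, taken over from Mauduit–Rivat, J. Eur. Math. Soc. 17 (2015), Def. 1) of the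
sequence of transducer outputs `n ↦ T(q, (n)_k)`, which is one of the two hypotheses of the
Mauduit–Rivat type estimate Thm. 4.4 through which Prop. 3.2, hence the named fact
`Literature.NumberTheory.LFunctions.mullner_moebius_automatic`, is proved in the paper.

* `carryViolations k f λ α ρ`, `HasCarryProperty k η C f` — Def. 4.1 for a GROUP-valued
  `f : ℕ → G` with the literal periodic truncation `f_{α+ρ}(n) = f(n mod k^{α+ρ})`: the number of
  `ℓ < k^λ` admitting `n₁, n₂ < k^α` with
  `f(ℓk^α+n₁+n₂) f(ℓk^α+n₁)⁻¹ ≠ f_{α+ρ}(ℓk^α+n₁+n₂) f_{α+ρ}(ℓk^α+n₁)⁻¹` is `≤ C k^{λ − ηρ}`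
  for all `ρ < λ`. (Müllner writes `f(x)^H f(y)` for unitary matrices; the tree's transducer
  composes outputs with the prefix on the RIGHT, `T(M, v w) = T(δ(M,v), w) · T(M, v)` in
  `Equiv.Perm`, so the prefix-cancelling quotient is `f(x) f(y)⁻¹`; under a unitary
  representation of this group it becomes `D(f(x)) D(f(y))^H`.)
* zero-stable states: `M.next [0] = M`, `T(M, 0) = id`; then `T(M, ·)` ignores leading zeros
  (`MinImage.T_msbBlock_eq`), so `f(n) = T(M, (n)_k)` and all its truncations read padded blocks.
* `MinImage.carry_eq_of_sync` — the mechanism of Lemma 4.10: if `x = ℓk^α+n₁+n₂` and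
  `y = ℓk^α+n₁` agree above digit `α+v` (`v < ρ`) and the digit block of `y` in positions
  `[α+v+1, α+ρ)` contains a synchronizing word of the transducer, then `ℓ` is no violation.
* `MinImage.card_carryViolations_le` and **Lemma 4.10** `MinImage.hasCarryProperty_T`: for a
  zero-stable state `M` of the transducer of a base-`k` automaton (letters `≥ k` trivial),
  `n ↦ T(M, (n)_k)` has the carry property, with `η` from the exponential count of blocks
  avoiding the synchronizing word (`card_syncBad_mul_le`), as in the paper.

Scope. Müllner states Lemma 4.10 for `f(n) = D(T(q₀,(n+r)_k))` uniformly in a shift `r`; the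
shift is only needed for the symbolic dynamical system (Lemma 3.1) and is not formalised here;
zero-stability of the root is what makes the literal truncation `f(n mod k^λ)` of Def. 4.1 read
the padded lower block, and is available after the base change `k ↦ k^p` of Prop. 2.25
(`MinImage.exists_zeroStable_pow` below records the elementary existence statement).

## References
* C. Müllner, Duke Math. J. 166 (2017) = arXiv:1602.03042: Def. 4.1 (p. 19), Lemma 4.10 (p. 22).
  [Mullner2017]
* C. Mauduit, J. Rivat, *Prime numbers along Rudin–Shapiro sequences*, J. Eur. Math. Soc. 17
  (2015) 2595–2642, Definition 1 (carry property). (cited through Müllner 2017)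
-/

noncomputable section

open Finset

namespace Literature.NumberTheory.LFunctions

/-! ## Definition 4.1 for group-valued sequences -/

section CarryDef

variable {G : Type*} [Group G]

/-- The CARRY VIOLATIONS of `f : ℕ → G` at scales `(λ, α, ρ)` (Müllner Def. 4.1, Mauduit–Rivat
2015 Def. 1, group-valued form with the prefix-cancelling quotient `f(x) f(y)⁻¹`): the
`ℓ < k^λ` for which some `n₁, n₂ < k^α` give
`f(ℓk^α+n₁+n₂) f(ℓk^α+n₁)⁻¹ ≠ f_{α+ρ}(ℓk^α+n₁+n₂) f_{α+ρ}(ℓk^α+n₁)⁻¹`, `f_P(n) := f(n mod k^P)`.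
[cite: Mullner2017, Def. 4.1] -/
def carryViolations (k : ℕ) (f : ℕ → G) (lam α ρ : ℕ) : Finset ℕ := by
  classical
  exact (range (k ^ lam)).filter fun ℓ => ∃ n₁ < k ^ α, ∃ n₂ < k ^ α,
      f (ℓ * k ^ α + n₁ + n₂) * (f (ℓ * k ^ α + n₁))⁻¹ ≠
        f ((ℓ * k ^ α + n₁ + n₂) % k ^ (α + ρ)) * (f ((ℓ * k ^ α + n₁) % k ^ (α + ρ)))⁻¹

/-- Membership in `carryViolations`. [folklore] -/
theorem mem_carryViolations {k : ℕ} {f : ℕ → G} {lam α ρ ℓ : ℕ} :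
    ℓ ∈ carryViolations k f lam α ρ ↔ ℓ < k ^ lam ∧ ∃ n₁ < k ^ α, ∃ n₂ < k ^ α,
      f (ℓ * k ^ α + n₁ + n₂) * (f (ℓ * k ^ α + n₁))⁻¹ ≠
        f ((ℓ * k ^ α + n₁ + n₂) % k ^ (α + ρ)) * (f ((ℓ * k ^ α + n₁) % k ^ (α + ρ)))⁻¹ := by
  classical
  simp [carryViolations]

/-- **Müllner 2017, Def. 4.1 (the carry property)** for a group-valued `f : ℕ → G`, with
explicit constants: `#carryViolations(λ, α, ρ) ≤ C k^{λ − η ρ}` for all `λ, α, ρ` with `ρ < λ`.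
[cite: Mullner2017, Def. 4.1] -/
def HasCarryProperty (k : ℕ) (η C : ℝ) (f : ℕ → G) : Prop :=
  ∀ lam α ρ : ℕ, ρ < lam →
    ((carryViolations k f lam α ρ).card : ℝ) ≤ C * (k : ℝ) ^ ((lam : ℝ) - η * ρ)

end CarryDef

/-! ## Zero-stable states and padded blocks -/

namespace MinImage

variable {σ : Type*} [Fintype σ] [DecidableEq σ] {δ : σ → ℕ → σ}

/-- One letter, then the rest: `T(M, d w) = T(δ(M, d), w) · T(M, d)`. [folklore] -/
theorem T_cons (M : MinImage δ) (d : ℕ) (w : List ℕ) :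
    M.T (d :: w) = (M.next [d]).T w * M.T [d] := by
  rw [show d :: w = [d] ++ w from rfl, T_append, Equiv.Perm.mul_def]

/-- `T(M, v w) = T(δ(M,v), w) · T(M, v)` in the group `Perm`. [folklore] -/
theorem T_append_mul (M : MinImage δ) (v w : List ℕ) :
    M.T (v ++ w) = (M.next v).T w * M.T v := by
  rw [T_append, Equiv.Perm.mul_def]

/-- A state fixed by the letter `0` is fixed by `0^j`. [folklore] -/
theorem next_replicate_zero {M : MinImage δ} (h0 : M.next [0] = M) (j : ℕ) :
    M.next (List.replicate j 0) = M := by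
  induction j with
  | zero => exact M.next_nil
  | succ j ih => rw [List.replicate_succ, show (0 :: List.replicate j 0) =
      [0] ++ List.replicate j 0 from rfl, next_append, h0, ih]

/-- A ZERO-STABLE state (`δ(M,0) = M`, `T(M,0) = id`) has trivial output along `0^j`. [folklore] -/
theorem T_replicate_zero {M : MinImage δ} (h0 : M.next [0] = M) (h1 : M.T [0] = 1) (j : ℕ) :
    M.T (List.replicate j 0) = 1 := by
  induction j with
  | zero => exact M.T_nil
  | succ j ih => rw [List.replicate_succ, T_cons, h0, ih, h1, mul_one]

/-- Leading zeros are invisible from a zero-stable state. [folklore] -/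
theorem T_replicate_zero_append {M : MinImage δ} (h0 : M.next [0] = M) (h1 : M.T [0] = 1)
    (j : ℕ) (w : List ℕ) : M.T (List.replicate j 0 ++ w) = M.T w := by
  rw [T_append_mul, next_replicate_zero h0, T_replicate_zero h0 h1, mul_one]

/-- The state after leading zeros and a word, from a zero-stable state. [folklore] -/
theorem next_replicate_zero_append {M : MinImage δ} (h0 : M.next [0] = M) (j : ℕ) (w : List ℕ) :
    M.next (List.replicate j 0 ++ w) = M.next w := by
  rw [next_append, next_replicate_zero h0]

/-- **Padded = unpadded from a zero-stable state**: `T(M, (n)_k^L) = T(M, (n)_k)` for every `L`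
(the padded block is `0^{L - len} (n)_k`). Hence for `f(n) = T(M, (n)_k)` the literal truncation
`f(n mod k^L)` of Def. 4.1 reads the padded lower block of `n`. [cite: Mullner2017, §4.2] -/
theorem T_msbBlock_eq {M : MinImage δ} (h0 : M.next [0] = M) (h1 : M.T [0] = 1) (k L n : ℕ) :
    M.T (msbBlock k L n) = M.T ((Nat.digits k n).reverse) := by
  rw [msbBlock, Nat.digitsAppend, List.reverse_append, List.reverse_replicate,
    T_replicate_zero_append h0 h1]

/-- Same for the state reached. [folklore] -/
theorem next_msbBlock_eq {M : MinImage δ} (h0 : M.next [0] = M) (k L n : ℕ) :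
    M.next (msbBlock k L n) = M.next ((Nat.digits k n).reverse) := by
  rw [msbBlock, Nat.digitsAppend, List.reverse_append, List.reverse_replicate,
    next_replicate_zero_append h0]

/-- **A word containing a synchronizing word synchronizes**: if `w` contains a minimising word
`w₀` of the transducer then `δ(M, w)` does not depend on `M`. [cite: Mullner2017, Def. 2.1 (property 8)] -/
theorem next_eq_next_of_infix (M M' : MinImage δ) {w₀ w : List ℕ}
    (hw₀ : (fullImage δ w₀).card = minRank δ) (h : w₀ <:+: w) : M.next w = M'.next w := by
  obtain ⟨a, b, rfl⟩ := h
  rw [next_append, next_append, next_append, next_append,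
    next_eq_of_card_eq (M.next a) (M'.next a) hw₀]

/-! ## The mechanism of Lemma 4.10 -/

/-- Splitting a padded block at an inner position: for `c ≤ P'` (lengths), the block of length
`P'` of `z mod k^{P'}` is the block of length `P' - c` of `⌊z/k^c⌋ mod k^{P'-c}` followed by the
block of length `c` of `z mod k^c`. [folklore] -/
theorem msbBlock_mod_split {k : ℕ} (hk : 1 < k) (z c e : ℕ) :
    msbBlock k (e + c) (z % k ^ (e + c)) =
      msbBlock k e (z / k ^ c % k ^ e) ++ msbBlock k c (z % k ^ c) := by
  have hk0 : 0 < k := by omega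
  have h1 : z % k ^ (e + c) / k ^ c = z / k ^ c % k ^ e := by
    rw [pow_add, mul_comm, Nat.mod_mul_right_div_self]
  have h2 : z % k ^ (e + c) % k ^ c = z % k ^ c :=
    Nat.mod_mod_of_dvd z (pow_dvd_pow k (Nat.le_add_left c e))
  have h3 : z % k ^ (e + c) = k ^ c * (z / k ^ c % k ^ e) + z % k ^ c := by
    rw [← h1, ← h2]; exact (Nat.div_add_mod _ _).symm
  conv_lhs => rw [h3]
  exact msbBlock_add hk (Nat.mod_lt _ (pow_pos hk0 e)) (Nat.mod_lt _ (pow_pos hk0 c))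

/-- **The mechanism of Müllner's Lemma 4.10.** Let `M` be zero-stable and `f(n) = T(M, (n)_k)`.
If `x` and `y` agree above digit position `α + v` (`⌊x/k^{α+v+1}⌋ = ⌊y/k^{α+v+1}⌋`, `v < ρ`) and
the digits of `y` in positions `[α+v+1, α+ρ)` contain a synchronizing word `w₀` of the transducer,
then `f(x) f(y)⁻¹ = f_{α+ρ}(x) f_{α+ρ}(y)⁻¹`: the common prefix cancels on the left-hand side, and
on both sides the states from which the low blocks are read coincide after `w₀`.
[cite: Mullner2017, Lemma 4.10 (proof)] -/
theorem carry_eq_of_sync {k : ℕ} (hk : 2 ≤ k) {M : MinImage δ} (h0 : M.next [0] = M)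
    (h1 : M.T [0] = 1) {w₀ : List ℕ} (hw₀ : (fullImage δ w₀).card = minRank δ)
    {α ρ v x y : ℕ} (hv : v < ρ) (hxy : x / k ^ (α + v + 1) = y / k ^ (α + v + 1))
    (hmid : w₀ <:+: msbBlock k (ρ - v - 1) (y / k ^ (α + v + 1) % k ^ (ρ - v - 1))) :
    M.T ((Nat.digits k x).reverse) * (M.T ((Nat.digits k y).reverse))⁻¹ =
      M.T ((Nat.digits k (x % k ^ (α + ρ))).reverse) *
        (M.T ((Nat.digits k (y % k ^ (α + ρ))).reverse))⁻¹ := by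
  have hk1 : 1 < k := hk
  have hk0 : 0 < k := by omega
  -- lengths: `α + ρ = e + c` with `c = α + v + 1`, `e = ρ - v - 1`
  set c := α + v + 1 with hc
  set e := ρ - v - 1 with he
  have hec : α + ρ = e + c := by omega
  set P := k ^ (α + ρ) with hP
  have hPpos : 0 < P := pow_pos hk0 _
  -- the common quotient above `α + ρ`
  have hdivP : ∀ z, z / P = z / k ^ c / k ^ e := fun z => by
    rw [hP, hec, pow_add, mul_comm, ← Nat.div_div_eq_div_mul]
  have hxyP : x / P = y / P := by rw [hdivP, hdivP, hxy]
  -- padded readings of the four numbers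
  set Ltop := y / P with hLtop
  have htop : ∀ z, z / P = Ltop → M.T ((Nat.digits k z).reverse) =
      ((M.next (msbBlock k Ltop Ltop)).T (msbBlock k (α + ρ) (z % P))) *
        M.T (msbBlock k Ltop Ltop) := by
    intro z hz
    have hlt : Ltop < k ^ Ltop := Nat.lt_pow_self hk1
    rw [← T_msbBlock_eq h0 h1 k (Ltop + (α + ρ)) z]
    conv_lhs => rw [← Nat.div_add_mod z P, hz]
    rw [hP, msbBlock_add hk1 hlt (Nat.mod_lt _ hPpos), T_append_mul]
  have hlow : ∀ z, M.T ((Nat.digits k (z % P)).reverse) =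
      (M.next (msbBlock k e (z / k ^ c % k ^ e))).T (msbBlock k c (z % k ^ c)) *
        M.T (msbBlock k e (z / k ^ c % k ^ e)) := by
    intro z
    rw [← T_msbBlock_eq h0 h1 k (α + ρ) (z % P), hP, hec, msbBlock_mod_split hk1 z c e,
      T_append_mul]
  have hsplit : ∀ z, msbBlock k (α + ρ) (z % P) =
      msbBlock k e (z / k ^ c % k ^ e) ++ msbBlock k c (z % k ^ c) := fun z => by
    rw [hP, hec]; exact msbBlock_mod_split hk1 z c e
  -- the middle block is common and synchronizing
  have hmidx : x / k ^ c % k ^ e = y / k ^ c % k ^ e := by rw [hxy]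
  set mid := msbBlock k e (y / k ^ c % k ^ e) with hmid_def
  set M₁ := M.next (msbBlock k Ltop Ltop) with hM₁
  have hsync : (M₁.next mid) = M.next mid := next_eq_next_of_infix _ _ hw₀ hmid
  rw [htop x hxyP, htop y rfl, hlow x, hlow y, hsplit x, hsplit y, hmidx, T_append_mul,
    T_append_mul, ← hmid_def, hsync]
  group

/-! ## Covering the violations (the case distinction of Lemma 4.10) -/

/-- The bad `ℓ` of level `v < ρ` (Müllner: "we fix `t` … and count the number of integers `ℓ`
such that `((ℓ+r₁)/k^t)_k^{ρ-t}` is not synchronizing"; here `r = 0`, `t = v + 1`):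
`ℓ < k^λ` with `k^v ∣ ℓ + 1` whose digits in positions `[v+1, ρ)` avoid `w₀`.
[cite: Mullner2017, Lemma 4.10 (proof)] -/
def carryBad (k lam ρ v : ℕ) (w₀ : List ℕ) : Finset ℕ :=
  (range (k ^ lam)).filter fun ℓ => k ^ v ∣ ℓ + 1 ∧
    ¬ w₀ <:+: msbBlock k (ρ - v - 1) (ℓ / k ^ (v + 1) % k ^ (ρ - v - 1))

/-- The bad `ℓ` of top level: `k^ρ ∣ ℓ + 1` (the carry may run beyond position `α + ρ`).
[cite: Mullner2017, Lemma 4.10 (proof)] -/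
def carryBadTop (k lam ρ : ℕ) : Finset ℕ :=
  (range (k ^ lam)).filter fun ℓ => k ^ ρ ∣ ℓ + 1

/-- Membership in `carryBad`. [folklore] -/
theorem mem_carryBad {k lam ρ v ℓ : ℕ} {w₀ : List ℕ} :
    ℓ ∈ carryBad k lam ρ v w₀ ↔ ℓ < k ^ lam ∧ k ^ v ∣ ℓ + 1 ∧
      ¬ w₀ <:+: msbBlock k (ρ - v - 1) (ℓ / k ^ (v + 1) % k ^ (ρ - v - 1)) := by
  simp [carryBad]

/-- Membership in `carryBadTop`. [folklore] -/
theorem mem_carryBadTop {k lam ρ ℓ : ℕ} :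
    ℓ ∈ carryBadTop k lam ρ ↔ ℓ < k ^ lam ∧ k ^ ρ ∣ ℓ + 1 := by
  simp [carryBadTop]

/-- **The violations of `n ↦ T(M,(n)_k)` are covered by the bad sets** (`M` zero-stable, `w₀`
synchronizing): with `v = ν_k(ℓ+1)`, either `v ≥ ρ` (top level) or the numbers
`x = ℓk^α+n₁+n₂`, `y = ℓk^α+n₁` agree above position `α + v` — since `⌊x/k^α⌋ ∈ {ℓ, ℓ+1}` and
`k^{v+1} ∤ ℓ + 1` — so that a violation forces the block `[v+1, ρ)` of `ℓ` to avoid `w₀`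
(`carry_eq_of_sync`). [cite: Mullner2017, Lemma 4.10 (proof)] -/
theorem carryViolations_subset {k : ℕ} (hk : 2 ≤ k) {M : MinImage δ} (h0 : M.next [0] = M)
    (h1 : M.T [0] = 1) {w₀ : List ℕ} (hw₀ : (fullImage δ w₀).card = minRank δ) (lam α ρ : ℕ) :
    carryViolations k (fun n => M.T ((Nat.digits k n).reverse)) lam α ρ ⊆
      carryBadTop k lam ρ ∪ (range ρ).biUnion fun v => carryBad k lam ρ v w₀ := by
  have hk1 : 1 < k := hk
  have hk0 : 0 < k := by omega
  have hkne : k ≠ 1 := by omega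
  intro ℓ hℓ
  rw [mem_carryViolations] at hℓ
  obtain ⟨hℓlam, n₁, hn₁, n₂, hn₂, hne⟩ := hℓ
  set A := k ^ α with hA
  have hApos : 0 < A := pow_pos hk0 α
  set t := padicValNat k (ℓ + 1) with ht
  rw [mem_union, mem_biUnion]
  by_cases hρt : ρ ≤ t
  · left
    rw [mem_carryBadTop]
    exact ⟨hℓlam, (Nat.pow_dvd_iff_le_padicValNat hkne (by omega : ℓ + 1 ≠ 0)).2 hρt⟩
  · right
    have htρ : t < ρ := not_le.1 hρt
    refine ⟨t, mem_range.2 htρ, mem_carryBad.2 ⟨hℓlam, pow_padicValNat_dvd, fun hmid => hne ?_⟩⟩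
    -- the two numbers agree above position `α + t`
    have hy : (ℓ * A + n₁) / A = ℓ := by
      rw [mul_comm, Nat.mul_add_div hApos, Nat.div_eq_of_lt hn₁, add_zero]
    have hx : (ℓ * A + n₁ + n₂) / A = ℓ ∨ (ℓ * A + n₁ + n₂) / A = ℓ + 1 := by
      rw [add_assoc, mul_comm, Nat.mul_add_div hApos]
      have : (n₁ + n₂) / A ≤ 1 := by
        rw [Nat.div_le_iff_le_mul_add_pred hApos]; omega
      rcases Nat.le_one_iff_eq_zero_or_eq_one.1 this with h | h
      · left; rw [h, add_zero]
      · right; rw [h]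
    have hnot : ¬ k ^ (t + 1) ∣ ℓ + 1 := by
      rw [Nat.pow_dvd_iff_le_padicValNat hkne (by omega : ℓ + 1 ≠ 0), ← ht]; omega
    have hxy : (ℓ * A + n₁ + n₂) / k ^ (α + t + 1) = (ℓ * A + n₁) / k ^ (α + t + 1) := by
      rw [show α + t + 1 = α + (t + 1) by ring, pow_add, ← hA, ← Nat.div_div_eq_div_mul,
        ← Nat.div_div_eq_div_mul, hy]
      rcases hx with h | h
      · rw [h]
      · rw [h, Nat.succ_div_of_not_dvd hnot]
    have hyq : (ℓ * A + n₁) / k ^ (α + t + 1) = ℓ / k ^ (t + 1) := by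
      rw [show α + t + 1 = α + (t + 1) by ring, pow_add, ← hA, ← Nat.div_div_eq_div_mul, hy]
    have h := carry_eq_of_sync hk h0 h1 hw₀ (α := α) htρ hxy (by rw [hyq]; exact hmid)
    simpa only [hA] using h

/-! ## Counting the bad sets -/

/-- `m ∣ ℓ + 1` pins down `ℓ mod m = m - 1`. [folklore] -/
theorem mod_eq_sub_one_of_dvd_succ {m ℓ : ℕ} (hm : 0 < m) (h : m ∣ ℓ + 1) : ℓ % m = m - 1 := by
  obtain ⟨c, hc⟩ := h
  rcases c with _ | c
  · simp at hc
  · have hℓ : ℓ = m * c + (m - 1) := by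
      rw [Nat.mul_succ] at hc; omega
    rw [hℓ, Nat.mul_add_mod, Nat.mod_eq_of_lt (Nat.sub_lt hm one_pos)]

/-- The top-level bad set has at most `k^{λ - ρ}` elements (`ρ ≤ λ`): `ℓ` is determined by
`⌊ℓ / k^ρ⌋`. [cite: Mullner2017, Lemma 4.10 (proof)] -/
theorem card_carryBadTop_le {k lam ρ : ℕ} (hk : 2 ≤ k) (hρ : ρ ≤ lam) :
    (carryBadTop k lam ρ).card ≤ k ^ (lam - ρ) := by
  have hk0 : 0 < k := by omega
  have hKpos : 0 < k ^ ρ := pow_pos hk0 ρ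
  rw [← card_range (k ^ (lam - ρ))]
  refine card_le_card_of_injOn (fun ℓ => ℓ / k ^ ρ) (fun ℓ hℓ => ?_) ?_
  · rw [mem_coe, mem_carryBadTop] at hℓ
    rw [mem_coe, mem_range, Nat.div_lt_iff_lt_mul hKpos, ← pow_add, Nat.sub_add_cancel hρ]
    exact hℓ.1
  · intro ℓ₁ h₁ ℓ₂ h₂ h
    rw [mem_coe, mem_carryBadTop] at h₁ h₂
    simp only at h
    rw [← Nat.div_add_mod ℓ₁ (k ^ ρ), ← Nat.div_add_mod ℓ₂ (k ^ ρ), h,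
      mod_eq_sub_one_of_dvd_succ hKpos h₁.2, mod_eq_sub_one_of_dvd_succ hKpos h₂.2]

/-- Reconstruction of `ℓ ∈ carryBad(v)` from `⌊ℓ/k^ρ⌋`, the middle block value and the digit at
position `v`. [folklore] -/
theorem eq_of_mem_carryBad {k lam ρ v ℓ : ℕ} {w₀ : List ℕ} (hk : 2 ≤ k) (hv : v < ρ)
    (hℓ : ℓ ∈ carryBad k lam ρ v w₀) :
    ℓ = k ^ ρ * (ℓ / k ^ ρ) + (k ^ (v + 1) * (ℓ / k ^ (v + 1) % k ^ (ρ - v - 1)) +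
      (k ^ v * (ℓ / k ^ v % k) + (k ^ v - 1))) := by
  have hk0 : 0 < k := by omega
  rw [mem_carryBad] at hℓ
  have h1 : ℓ % k ^ v = k ^ v - 1 := mod_eq_sub_one_of_dvd_succ (pow_pos hk0 v) hℓ.2.1
  have h2 : ℓ % k ^ (v + 1) = k ^ v * (ℓ / k ^ v % k) + ℓ % k ^ v := by
    have := Nat.div_add_mod (ℓ % k ^ (v + 1)) (k ^ v)
    rw [pow_succ, Nat.mod_mul_right_div_self, Nat.mod_mod_of_dvd ℓ (dvd_mul_right (k ^ v) k)]
      at this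
    rw [pow_succ]; exact this.symm
  have h3 : ℓ % k ^ ρ = k ^ (v + 1) * (ℓ / k ^ (v + 1) % k ^ (ρ - v - 1)) + ℓ % k ^ (v + 1) := by
    have hsplit : k ^ ρ = k ^ (v + 1) * k ^ (ρ - v - 1) := by rw [← pow_add]; congr 1; omega
    have := Nat.div_add_mod (ℓ % k ^ ρ) (k ^ (v + 1))
    rw [hsplit, Nat.mod_mul_right_div_self,
      Nat.mod_mod_of_dvd ℓ (dvd_mul_right (k ^ (v + 1)) (k ^ (ρ - v - 1)))] at this
    rw [hsplit]; exact this.symm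
  conv_lhs => rw [← Nat.div_add_mod ℓ (k ^ ρ), h3, h2, h1]

/-- The bad set of level `v < ρ ≤ λ` has at most `k^{λ-ρ} · #syncBad(ρ-v-1) · k` elements: the
digits `[ρ, λ)` are free, the block `[v+1, ρ)` avoids `w₀`, the digit `v` is free, the digits
`[0, v)` are `k - 1`. [cite: Mullner2017, Lemma 4.10 (proof)] -/
theorem card_carryBad_le {k lam ρ v : ℕ} {w₀ : List ℕ} (hk : 2 ≤ k) (hv : v < ρ) (hρ : ρ ≤ lam) :
    (carryBad k lam ρ v w₀).card ≤ k ^ (lam - ρ) * ((syncBad k (ρ - v - 1) w₀).card * k) := by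
  have hk0 : 0 < k := by omega
  have hKpos : 0 < k ^ ρ := pow_pos hk0 ρ
  calc (carryBad k lam ρ v w₀).card
      ≤ (range (k ^ (lam - ρ)) ×ˢ (syncBad k (ρ - v - 1) w₀ ×ˢ range k)).card := by
        refine card_le_card_of_injOn
          (fun ℓ => (ℓ / k ^ ρ, (ℓ / k ^ (v + 1) % k ^ (ρ - v - 1), ℓ / k ^ v % k)))
          (fun ℓ hℓ => ?_) ?_
        · rw [mem_coe] at hℓ
          have hℓ' := mem_carryBad.1 hℓ
          simp only [mem_coe, mem_product, mem_range, mem_syncBad]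
          refine ⟨?_, ⟨Nat.mod_lt _ (pow_pos hk0 _), hℓ'.2.2⟩, Nat.mod_lt _ hk0⟩
          rw [Nat.div_lt_iff_lt_mul hKpos, ← pow_add, Nat.sub_add_cancel hρ]
          exact hℓ'.1
        · intro ℓ₁ h₁ ℓ₂ h₂ h
          rw [mem_coe] at h₁ h₂
          simp only [Prod.mk.injEq] at h
          have e₁ := eq_of_mem_carryBad hk hv h₁
          have e₂ := eq_of_mem_carryBad hk hv h₂
          rw [h.1, h.2.1, h.2.2] at e₁
          exact e₁.trans e₂.symm
    _ = k ^ (lam - ρ) * ((syncBad k (ρ - v - 1) w₀).card * k) := by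
        rw [card_product, card_product, card_range, card_range]

/-- **The count of Lemma 4.10 in closed form**: for a zero-stable state `M` and a synchronizing
word `w₀` of the transducer, for `ρ ≤ λ`,
`#carryViolations(λ, α, ρ) ≤ k^{λ-ρ} (1 + k ∑_{j<ρ} #syncBad(j))`. [cite: Mullner2017, Lemma 4.10] -/
theorem card_carryViolations_le {k : ℕ} (hk : 2 ≤ k) {M : MinImage δ} (h0 : M.next [0] = M)
    (h1 : M.T [0] = 1) {w₀ : List ℕ} (hw₀ : (fullImage δ w₀).card = minRank δ) {lam α ρ : ℕ}
    (hρ : ρ ≤ lam) :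
    (carryViolations k (fun n => M.T ((Nat.digits k n).reverse)) lam α ρ).card ≤
      k ^ (lam - ρ) * (1 + k * ∑ j ∈ range ρ, (syncBad k j w₀).card) := by
  calc (carryViolations k (fun n => M.T ((Nat.digits k n).reverse)) lam α ρ).card
      ≤ (carryBadTop k lam ρ ∪ (range ρ).biUnion fun v => carryBad k lam ρ v w₀).card :=
        card_le_card (carryViolations_subset hk h0 h1 hw₀ lam α ρ)
    _ ≤ (carryBadTop k lam ρ).card + ((range ρ).biUnion fun v => carryBad k lam ρ v w₀).card :=
        card_union_le _ _
    _ ≤ k ^ (lam - ρ) + ∑ v ∈ range ρ, (carryBad k lam ρ v w₀).card :=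
        add_le_add (card_carryBadTop_le hk hρ) card_biUnion_le
    _ ≤ k ^ (lam - ρ) + ∑ v ∈ range ρ, k ^ (lam - ρ) * ((syncBad k (ρ - v - 1) w₀).card * k) := by
        gcongr with v hv
        exact card_carryBad_le hk (mem_range.1 hv) hρ
    _ = k ^ (lam - ρ) * (1 + k * ∑ j ∈ range ρ, (syncBad k j w₀).card) := by
        rw [← mul_sum, ← sum_range_reflect (fun j => (syncBad k j w₀).card) ρ, mul_sum, mul_sum,
          mul_add, mul_one, mul_sum]
        congr 1
        refine sum_congr rfl fun v hv => ?_
        rw [show ρ - 1 - v = ρ - v - 1 by omega]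
        ring

/-! ## Exponential decay of the blocks avoiding the synchronizing word -/

/-- One more digit costs at most a factor `k`: `#syncBad(L + 1) ≤ k · #syncBad(L)` (a block
avoiding `w` has its prefix avoiding `w`). [folklore] -/
theorem card_syncBad_succ_le {k : ℕ} (hk : 1 < k) (L : ℕ) (w : List ℕ) :
    (syncBad k (L + 1) w).card ≤ k * (syncBad k L w).card := by
  have hk0 : 0 < k := by omega
  calc (syncBad k (L + 1) w).card ≤ (syncBad k L w ×ˢ range k).card := by
        refine card_le_card_of_injOn (fun r => (r / k, r % k)) (fun r hr => ?_) ?_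
        · rw [mem_coe, mem_syncBad] at hr
          have hdiv : r / k < k ^ L := by
            rw [Nat.div_lt_iff_lt_mul hk0, ← pow_succ]; exact hr.1
          have hsplit : msbBlock k (L + 1) r = msbBlock k L (r / k) ++ msbBlock k 1 (r % k) := by
            conv_lhs => rw [← Nat.div_add_mod r k, ← pow_one k]
            rw [pow_one]
            have := msbBlock_add hk hdiv (c := r % k) (ℓ := 1) (by rw [pow_one]; exact Nat.mod_lt r hk0)
            rw [pow_one] at this
            exact this
          simp only [mem_coe, mem_product, mem_syncBad, mem_range]
          refine ⟨⟨hdiv, fun h => hr.2 ?_⟩, Nat.mod_lt r hk0⟩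
          rw [hsplit]
          exact h.trans (List.prefix_append _ _).isInfix
        · intro r₁ _ r₂ _ h
          simp only [Prod.mk.injEq] at h
          rw [← Nat.div_add_mod r₁ k, ← Nat.div_add_mod r₂ k, h.1, h.2]
    _ = k * (syncBad k L w).card := by rw [card_product, card_range, mul_comm]

/-- `#syncBad(|w| i + t) ≤ k^t (k^{|w|} − 1)^i`. [cite: Mullner2017, §3.1] -/
theorem card_syncBad_mul_add_le {k : ℕ} (hk : 1 < k) {w : List ℕ} (hw : ∀ d ∈ w, d < k)
    (i t : ℕ) : (syncBad k (w.length * i + t) w).card ≤ k ^ t * (k ^ w.length - 1) ^ i := by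
  induction t with
  | zero => simpa using card_syncBad_mul_le hk hw i
  | succ t ih =>
    rw [← add_assoc, pow_succ]
    calc (syncBad k (w.length * i + t + 1) w).card ≤ k * (syncBad k (w.length * i + t) w).card :=
          card_syncBad_succ_le hk _ w
      _ ≤ k * (k ^ t * (k ^ w.length - 1) ^ i) := Nat.mul_le_mul_left k ih
      _ = k ^ t * k * (k ^ w.length - 1) ^ i := by ring

/-- **Uniform exponential bound**: with `s = |w| ≥ 1` and `θ = (k^s − 1)/k^s`,
`#syncBad(j) ≤ k^j θ^{⌊j/s⌋}` for every `j`. [cite: Mullner2017, §3.1] -/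
theorem card_syncBad_le_real {k : ℕ} (hk : 1 < k) {w : List ℕ} (hw : ∀ d ∈ w, d < k)
    (j : ℕ) :
    ((syncBad k j w).card : ℝ) ≤ (k : ℝ) ^ j *
      ((((k ^ w.length - 1 : ℕ) : ℝ) / (k : ℝ) ^ w.length) ^ (j / w.length)) := by
  set s := w.length with hs_def
  have hk0 : (0 : ℝ) < k := by exact_mod_cast (show 0 < k by omega)
  have hks : (0 : ℝ) < (k : ℝ) ^ s := pow_pos hk0 s
  have hj : s * (j / s) + j % s = j := Nat.div_add_mod j s
  have h := card_syncBad_mul_add_le hk hw (j / s) (j % s)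
  rw [← hs_def, hj] at h
  have h' : ((syncBad k j w).card : ℝ) ≤ (k : ℝ) ^ (j % s) * ((k ^ s - 1 : ℕ) : ℝ) ^ (j / s) := by
    exact_mod_cast h
  refine h'.trans (le_of_eq ?_)
  rw [div_pow, mul_div_assoc', eq_div_iff (pow_ne_zero _ hks.ne'), ← pow_mul, mul_assoc,
    mul_comm (((k ^ s - 1 : ℕ) : ℝ) ^ (j / s)), ← mul_assoc, ← pow_add]
  congr 1
  rw [add_comm, hj]

/-! ## Lemma 4.10 -/

/-- Prepending a letter keeps a minimising word minimising. [folklore] -/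
theorem card_fullImage_cons_eq {a : ℕ} {w : List ℕ} (hw : (fullImage δ w).card = minRank δ) :
    (fullImage δ (a :: w)).card = minRank δ := by
  refine le_antisymm ?_ (minRank_le_card_fullImage δ _)
  rw [← hw, show a :: w = [a] ++ w from rfl]
  exact card_le_card (fullImage_append_subset δ [a] w)

/-- **A synchronizing digit word with a prescribed first letter** exists (letters `≥ k` acting
trivially): filter a minimising word to its digits and prepend the letter. [folklore] -/
theorem exists_sync_digit_word {k : ℕ} (htriv : ∀ q d, k ≤ d → δ q d = q) {a : ℕ} (ha : a < k) :
    ∃ w₀ : List ℕ, (∀ d ∈ w₀, d < k) ∧ 0 < w₀.length ∧ (fullImage δ w₀).card = minRank δ := by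
  obtain ⟨w, hw⟩ := exists_card_fullImage_eq_minRank δ
  refine ⟨a :: w.filter (· < k), ?_, by simp, card_fullImage_cons_eq ?_⟩
  · intro d hd
    rcases List.mem_cons.1 hd with rfl | h
    · exact ha
    · exact mem_filter_lt h
  · rw [← hw, fullImage, fullImage]
    congr 1
    exact image_congr fun q _ => (wordAct_filter_of_trivial htriv w q).symm

/-- A finite geometric sum with ratio `x ≥ 4/3` is at most `3 x^ρ`. [folklore] -/
theorem geom_sum_le_three_mul_pow {x : ℝ} (hx : 4 / 3 ≤ x) (ρ : ℕ) :
    ∑ j ∈ range ρ, x ^ j ≤ 3 * x ^ ρ := by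
  have hx1 : x ≠ 1 := by intro h; rw [h] at hx; norm_num at hx
  have hpos : 0 < x - 1 := by linarith
  rw [geom_sum_eq hx1, div_le_iff₀ hpos]
  have : 0 ≤ x ^ ρ := pow_nonneg (by linarith) ρ
  nlinarith

/-- **Müllner 2017, Lemma 4.10 (the carry property of the transducer output).** For a base-`k`
automaton (`k ≥ 2`, letters `≥ k` acting trivially) there are `η > 0` and `C` such that for every
ZERO-STABLE state `M` of its naturally induced transducer the sequence `n ↦ T(M, (n)_k)` has the
carry property `HasCarryProperty k η C`: the violations at scale `(λ, α, ρ)` are covered by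
`k^ρ ∣ ℓ + 1` and, for `v = ν_k(ℓ+1) < ρ`, by the `ℓ` whose digit block `[v+1, ρ)` avoids a
synchronizing word `w₀` (`carryViolations_subset`); these are
`≤ k^{λ-ρ}(1 + k ∑_{j<ρ} #syncBad(j)) ≤ C k^λ ψ^ρ = C k^{λ − ηρ}` with `ψ < 1` from
`#syncBad(j) ≤ k^j θ^{⌊j/|w₀|⌋}`, `θ = 1 − k^{-|w₀|}` — Müllner's
`η = log(k^{ℓ₀}/(k^{ℓ₀}−1))/log k^{ℓ₀}` up to the harmless weakening `ψ ↦ max(ψ, 2/3)`.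
[cite: Mullner2017, Lemma 4.10] -/
theorem hasCarryProperty_T {k : ℕ} (hk : 2 ≤ k) (htriv : ∀ q d, k ≤ d → δ q d = q) :
    ∃ η : ℝ, 0 < η ∧ ∃ C : ℝ, ∀ M : MinImage δ, M.next [0] = M → M.T [0] = 1 →
      HasCarryProperty k η C (fun n => M.T ((Nat.digits k n).reverse)) := by
  have hk1 : 1 < k := hk
  have hk0 : 0 < k := by omega
  have hkR : (1 : ℝ) < k := by exact_mod_cast hk1
  have hkR0 : (0 : ℝ) < k := by linarith
  obtain ⟨w₀, hw₀d, hw₀len, hw₀⟩ := exists_sync_digit_word (δ := δ) htriv hk0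
  set s := w₀.length with hs
  -- the ratio `θ = (k^s - 1)/k^s ∈ (0, 1)` and its `s`-th root `ψ`
  have hks1 : 1 < k ^ s := Nat.one_lt_pow hw₀len.ne' hk1
  set θ : ℝ := ((k ^ s - 1 : ℕ) : ℝ) / (k : ℝ) ^ s with hθ
  have hksR : (0 : ℝ) < (k : ℝ) ^ s := pow_pos hkR0 s
  have hθnum : ((k ^ s - 1 : ℕ) : ℝ) = (k : ℝ) ^ s - 1 := by
    rw [Nat.cast_sub hks1.le]; push_cast; ring
  have hθpos : 0 < θ := by
    rw [hθ, hθnum]; apply div_pos _ hksR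
    have : (1 : ℝ) < (k : ℝ) ^ s := by exact_mod_cast hks1
    linarith
  have hθlt : θ < 1 := by
    rw [hθ, hθnum, div_lt_one hksR]; linarith
  set ψ : ℝ := θ ^ ((s : ℝ)⁻¹) with hψ
  have hψs : ψ ^ s = θ := Real.rpow_inv_natCast_pow hθpos.le hw₀len.ne'
  have hψpos : 0 < ψ := Real.rpow_pos_of_pos hθpos _
  have hψlt : ψ < 1 := by
    by_contra h
    have : 1 ≤ ψ ^ s := one_le_pow₀ (not_lt.1 h)
    rw [hψs] at this
    linarith
  set ψ₁ : ℝ := max ψ (2 / 3) with hψ₁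
  have hψ₁pos : 0 < ψ₁ := hψpos.trans_le (le_max_left _ _)
  have hψ₁lt : ψ₁ < 1 := max_lt hψlt (by norm_num)
  have hψψ₁ : ψ ≤ ψ₁ := le_max_left _ _
  have hkψ₁ : 4 / 3 ≤ k * ψ₁ := by
    have h2 : (2 : ℝ) ≤ k := by exact_mod_cast hk
    have h3 : (2 : ℝ) / 3 ≤ ψ₁ := le_max_right _ _
    nlinarith
  -- the exponent `η` and the constant `C`
  set η : ℝ := -Real.log ψ₁ / Real.log k with hη
  have hlogk : 0 < Real.log k := Real.log_pos hkR
  have hlogψ₁ : Real.log ψ₁ < 0 := Real.log_neg hψ₁pos hψ₁lt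
  have hηpos : 0 < η := div_pos (by linarith) hlogk
  set C : ℝ := 1 + 3 * k / θ with hC
  refine ⟨η, hηpos, C, fun M h0 h1 lam α ρ hρ => ?_⟩
  -- (1) the integer count
  have hcount := card_carryViolations_le hk h0 h1 hw₀ (lam := lam) (α := α) hρ.le
  -- (2) the sum of `#syncBad(j)`
  have hsync : ∀ j : ℕ, ((syncBad k j w₀).card : ℝ) ≤ θ⁻¹ * (k * ψ₁) ^ j := by
    intro j
    refine (card_syncBad_le_real hk1 hw₀d j).trans ?_
    rw [← hs, ← hθ]
    -- `θ^{⌊j/s⌋} = ψ^{s ⌊j/s⌋} ≤ ψ^j / θ`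
    have hj : s * (j / s) + j % s = j := Nat.div_add_mod j s
    have hjs : j ≤ s * (j / s) + s := by
      have := Nat.mod_lt j hw₀len; omega
    have h1' : θ ^ (j / s) * θ ≤ ψ ^ j := by
      rw [← hψs, ← pow_mul, ← pow_add]
      exact pow_le_pow_of_le_one hψpos.le hψlt.le hjs
    have h2 : θ ^ (j / s) ≤ θ⁻¹ * ψ ^ j := by
      rw [le_inv_mul_iff₀ hθpos, mul_comm]; exact h1'
    calc (k : ℝ) ^ j * θ ^ (j / s) ≤ (k : ℝ) ^ j * (θ⁻¹ * ψ ^ j) := by gcongr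
      _ = θ⁻¹ * (k * ψ) ^ j := by rw [mul_pow]; ring
      _ ≤ θ⁻¹ * (k * ψ₁) ^ j := by gcongr
  have hsum : (∑ j ∈ range ρ, ((syncBad k j w₀).card : ℝ)) ≤ θ⁻¹ * (3 * (k * ψ₁) ^ ρ) := by
    calc (∑ j ∈ range ρ, ((syncBad k j w₀).card : ℝ)) ≤ ∑ j ∈ range ρ, θ⁻¹ * (k * ψ₁) ^ j :=
          sum_le_sum fun j _ => hsync j
      _ = θ⁻¹ * ∑ j ∈ range ρ, (k * ψ₁) ^ j := by rw [mul_sum]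
      _ ≤ θ⁻¹ * (3 * (k * ψ₁) ^ ρ) := by
          gcongr
          exact geom_sum_le_three_mul_pow hkψ₁ ρ
  -- (3) assemble: `k^{λ-ρ} (1 + k Σ) ≤ C k^λ ψ₁^ρ`
  have hpow : (k : ℝ) ^ (lam - ρ) * (k : ℝ) ^ ρ = (k : ℝ) ^ lam := by
    rw [← pow_add, Nat.sub_add_cancel hρ.le]
  have hone : (1 : ℝ) ≤ (k * ψ₁) ^ ρ := one_le_pow₀ (by linarith)
  have hmain : ((carryViolations k (fun n => M.T ((Nat.digits k n).reverse)) lam α ρ).card : ℝ)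
      ≤ C * (k : ℝ) ^ lam * ψ₁ ^ ρ := by
    have hc' : ((carryViolations k (fun n => M.T ((Nat.digits k n).reverse)) lam α ρ).card : ℝ)
        ≤ (k : ℝ) ^ (lam - ρ) * (1 + k * ∑ j ∈ range ρ, ((syncBad k j w₀).card : ℝ)) := by
      exact_mod_cast hcount
    refine hc'.trans ?_
    calc (k : ℝ) ^ (lam - ρ) * (1 + k * ∑ j ∈ range ρ, ((syncBad k j w₀).card : ℝ))
        ≤ (k : ℝ) ^ (lam - ρ) * (1 + k * (θ⁻¹ * (3 * (k * ψ₁) ^ ρ))) := by gcongr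
      _ ≤ (k : ℝ) ^ (lam - ρ) * ((1 + 3 * k / θ) * (k * ψ₁) ^ ρ) := by
          gcongr
          have : k * (θ⁻¹ * (3 * (k * ψ₁) ^ ρ)) = 3 * k / θ * (k * ψ₁) ^ ρ := by
            field_simp
          rw [this, add_mul, one_mul]
          gcongr
      _ = C * (k : ℝ) ^ lam * ψ₁ ^ ρ := by rw [hC, mul_pow, ← hpow]; ring
  -- (4) `k^λ ψ₁^ρ = k^{λ - ηρ}`
  have hrpow : (k : ℝ) ^ lam * ψ₁ ^ ρ = (k : ℝ) ^ ((lam : ℝ) - η * ρ) := by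
    have hexp : (k : ℝ) ^ (-(η * ρ)) = ψ₁ ^ ρ := by
      rw [Real.rpow_def_of_pos hkR0, hη]
      have : Real.log k * -(-Real.log ψ₁ / Real.log k * ρ) = ρ * Real.log ψ₁ := by
        field_simp
      rw [this, Real.exp_nat_mul, Real.exp_log hψ₁pos]
    rw [sub_eq_add_neg, Real.rpow_add hkR0, Real.rpow_natCast, hexp]
  calc ((carryViolations k (fun n => M.T ((Nat.digits k n).reverse)) lam α ρ).card : ℝ)
      ≤ C * (k : ℝ) ^ lam * ψ₁ ^ ρ := hmain
    _ = C * (k : ℝ) ^ ((lam : ℝ) - η * ρ) := by rw [mul_assoc, hrpow]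

/-! ## Zero-stable states exist after a base change -/

/-- Iterating the letter `0`: `(M ↦ δ(M, 0))^[j] M = δ(M, 0^j)`. [folklore] -/
theorem iterate_next_zero (M : MinImage δ) (j : ℕ) :
    (fun N : MinImage δ => N.next [0])^[j] M = M.next (List.replicate j 0) := by
  induction j generalizing M with
  | zero => exact M.next_nil.symm
  | succ j ih =>
    rw [Function.iterate_succ, Function.comp_apply, ih, List.replicate_succ,
      show (0 :: List.replicate j 0) = [0] ++ List.replicate j 0 from rfl, next_append]

/-- Powers of a zero block. [folklore] -/
theorem flatten_replicate_replicate_zero (o c : ℕ) :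
    (List.replicate o (List.replicate c 0)).flatten = List.replicate (c * o) 0 := by
  induction o with
  | zero => simp
  | succ o ih => rw [List.replicate_succ, List.flatten_cons, ih, Nat.mul_succ, add_comm,
      List.replicate_add]

/-- **Zero-stable states exist in a suitable power base**: some state `M` of the transducer and
some `p ≥ 1` satisfy `δ(M, 0^p) = M` and `T(M, 0^p) = id`; in base `k^p` (whose letter `0` is
the block `0^p`, Müllner Prop. 2.25) `M` is zero-stable. (Pigeonhole on the orbit of the letter
`0`, then the order of the loop output.) [cite: Mullner2017, Prop. 2.25 / Thm. 2.16 (k₀(A))] -/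
theorem exists_zeroStable_pow (δ : σ → ℕ → σ) :
    ∃ p : ℕ, 0 < p ∧ ∃ M : MinImage δ,
      M.next (List.replicate p 0) = M ∧ M.T (List.replicate p 0) = 1 := by
  classical
  set φ : MinImage δ → MinImage δ := fun N => N.next [0] with hφ
  set M₀ : MinImage δ := transducerBase δ
  -- pigeonhole on the orbit of `M₀`
  obtain ⟨i, j, hij, heq⟩ : ∃ i j : Fin (Fintype.card (MinImage δ) + 1), i ≠ j ∧
      φ^[i] M₀ = φ^[j] M₀ :=
    Fintype.exists_ne_map_eq_of_card_lt (fun i : Fin (Fintype.card (MinImage δ) + 1) => φ^[i] M₀)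
      (by simp)
  wlog hlt : (i : ℕ) < j generalizing i j
  · exact this j i hij.symm heq.symm (lt_of_le_of_ne (not_lt.1 hlt) (fun h => hij (Fin.ext h).symm))
  set c := (j : ℕ) - i with hc
  have hcpos : 0 < c := by omega
  set M := φ^[i] M₀ with hM
  have hloop : M.next (List.replicate c 0) = M := by
    rw [← iterate_next_zero, hM, ← Function.iterate_add_apply, hc, Nat.sub_add_cancel hlt.le]
    exact heq.symm
  set g := M.T (List.replicate c 0) with hg
  set o := orderOf g with ho
  have hopos : 0 < o := orderOf_pos g
  refine ⟨c * o, Nat.mul_pos hcpos hopos, M, ?_, ?_⟩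
  · rw [← flatten_replicate_replicate_zero, next_flatten_replicate hloop]
  · rw [← flatten_replicate_replicate_zero, T_flatten_replicate hloop, ← hg, ho, pow_orderOf_eq_one]

end MinImage

end Literature.NumberTheory.LFunctions
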